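import Mathlib
import Summits.NavierStokesRegularity.NavierStokesRegularity.Theses.AngularGalerkinLadder
import Summits.NavierStokesRegularity.NavierStokesRegularity.Cruxes.RungBlowupCofinal.Lines.leray

/-!
# cstrat-19959 g5 — census signatures (elaboration check only; nothing here is proposed or registered)

Typed shadows of the g5 STRATEGY-CENSUS addendum entries (all steady, `α = 0`), over the letters of the registered line
`Lines/leray.lean` (`IsSteadyLerayRungProfile`, `RungHasLerayProfile`, `rungIsSingular_of_rungHasLerayProfile`); the
same statements over `Lines/qlwave.lean`'s `IsPrecessingRungProfile L 0 …` are attached as item evidence (that variant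
could not be served by the crux-write farm on 2026-08-27, snapshot incoherent on `Lines.qlwave`).

* S⁺8 `BoundedAmplitudeProfilesCofinal` with `goal_of_boundedAmplitude : S⁺8 → RungBlowupCofinal` (proved);
* D8 `Base`, `Lift` with the glue `goal_of_base_lift : Base → Lift → RungBlowupCofinal` (proved) and the verdict
  `lift_of_goal : RungBlowupCofinal → Lift` (proved) — `Lift` is the crux modulo `Base`, so D8 is no decomposition;
* N9 `NoHollowProfiles` (statement only);
* N11 `BoundedAmplitudeCoresTrivial` (statement only; Tsai 1998 Thm 1 with `q = ∞` + local compactness).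
-/

open Summit.NavierStokesRegularity.FluidComputer.AngularLadder
open Summit.NavierStokesRegularity.NavierStokesRegularity.Cruxes.RungBlowupCofinal.Leray

namespace Summit.NavierStokesRegularity.NavierStokesRegularity.Cruxes.RungBlowupCofinal.CensusG5

local notation "ℝ³" => EuclideanSpace ℝ (Fin 3)

/-- The crux, by name. -/
abbrev Goal : Prop :=
  Summit.NavierStokesRegularity.NavierStokesRegularity.Theses.AngularGalerkinLadder.RungBlowupCofinal

/-- S⁺8 — BOUNDED-AMPLITUDE COFINAL STEADY PROFILES (typed shadow of the `b = 0` regime: `sup ‖U‖ ≤ M` uniformly in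
`L`, the Type-I constant `C = C(L)` free; no sector restriction). -/
def BoundedAmplitudeProfilesCofinal : Prop :=
  ∃ M : ℝ, ∀ L₀ : ℕ, ∃ L ≥ L₀, ∃ (C : ℝ) (U : ℝ³ → ℝ³) (Q : ℝ³ → ℝ) (E : ℝ³ → ℝ³),
    IsSteadyLerayRungProfile L C U Q E ∧ (∀ y, ‖U y‖ ≤ M) ∧ ∃ y, U y ≠ 0

/-- S⁺8 implies the crux (steady Leray lift of the leray line). -/
theorem goal_of_boundedAmplitude (h : BoundedAmplitudeProfilesCofinal) : Goal := by
  obtain ⟨M, hM⟩ := h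
  intro L₀
  obtain ⟨L, hL, C, U, Q, E, hP, -, hne⟩ := hM L₀
  exact ⟨L, hL, rungIsSingular_of_rungHasLerayProfile ⟨C, U, Q, E, hP, hne⟩⟩

/-- D8 — BASE: one rung (the CAP target of record, rung four). -/
def Base : Prop := RungIsSingular 4

/-- D8 — LIFT: above every singular rung there is another. -/
def Lift : Prop := ∀ L : ℕ, RungIsSingular L → ∃ L', L < L' ∧ RungIsSingular L'

/-- D8 glue (induction): `Base → Lift → Goal`. -/
theorem goal_of_base_lift (hB : Base) (hL : Lift) : Goal := by
  show ∀ L₀ : ℕ, ∃ L ≥ L₀, RungIsSingular L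
  have key : ∀ n : ℕ, ∃ L ≥ n, RungIsSingular L := by
    intro n
    induction n with
    | zero => exact ⟨4, Nat.zero_le _, hB⟩
    | succ k ih =>
      obtain ⟨L, hLk, hs⟩ := ih
      obtain ⟨L', hLL', hs'⟩ := hL L hs
      exact ⟨L', by omega, hs'⟩
  exact key

/-- … and the crux gives `Lift` outright, so `Lift` IS the crux modulo `Base`: the reason D8 is not a decomposition
(redirect test (c) fails). -/
theorem lift_of_goal (h : Goal) : Lift := by
  intro L _
  obtain ⟨L', hL', hs⟩ := h (L + 1)
  exact ⟨L', by omega, hs⟩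

/-- N9 — NO HOLLOW PROFILES (statement only; ODE unique continuation for the radial profile system): a steady rung
profile vanishing on a centred ball vanishes identically. -/
def NoHollowProfiles : Prop :=
  ∀ (L : ℕ) (C : ℝ) (U : ℝ³ → ℝ³) (Q : ℝ³ → ℝ) (E : ℝ³ → ℝ³) (r₀ : ℝ), 0 < r₀ →
    IsSteadyLerayRungProfile L C U Q E → (∀ y, ‖y‖ < r₀ → U y = 0) → ∀ y, U y = 0

/-- N11 — BOUNDED-AMPLITUDE CORES TRIVIALISE (Tsai 1998 Thm 1 with `q = ∞`: bounded weak solutions of Leray's system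
on `ℝ³` are constant; plus local compactness of `NS_L` profiles). Along any family of steady rung profiles on rungs
`Ls k → ∞` with a uniform sup bound and the normalisation `U k 0 = 0`, the local `L²` mass on every fixed ball tends
to `0`: all non-trivial structure escapes to `|y| → ∞`. Statement only (census N11). -/
def BoundedAmplitudeCoresTrivial : Prop :=
  ∀ (M : ℝ) (Ls : ℕ → ℕ) (C : ℕ → ℝ) (U : ℕ → ℝ³ → ℝ³) (Q : ℕ → ℝ³ → ℝ) (E : ℕ → ℝ³ → ℝ³),
    Filter.Tendsto Ls Filter.atTop Filter.atTop →
    (∀ k, IsSteadyLerayRungProfile (Ls k) (C k) (U k) (Q k) (E k)) →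
    (∀ k y, ‖U k y‖ ≤ M) → (∀ k, U k 0 = 0) →
    ∀ R : ℝ, 0 < R →
      Filter.Tendsto (fun k => ∫ y in Metric.ball (0 : ℝ³) R, ‖U k y‖ ^ 2) Filter.atTop (nhds 0)

end Summit.NavierStokesRegularity.NavierStokesRegularity.Cruxes.RungBlowupCofinal.CensusG5
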